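import Summits.BirchSwinnertonDyer.BirchSwinnertonDyer.Theorems.SignedLowerHalvesSmallImageLowerHalfBothSignsRttCharRoadE1InjTopCore
import Summits.BirchSwinnertonDyer.BirchSwinnertonDyer.Theorems.SignedLowerHalvesSmallImageLowerHalfBothSignsRttCharRoadE1InjTopCoord
import HarnessLib

/-!
# Route `SignedLowerHalves`, crux L `SmallImageLowerHalfBothSigns` (stmt-BirchSwinnertonDyer-23599), line `rtt_w3` v12 — glue `charRoad_injTop`,
# LEAD: THE COMPOSITION `injTop_of_inputs` (INJ_top from the T-side inputs; blocks DESC and I wired)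

WHY: the registered stub `stub_charRoad_ns` (v12, `Lines/rtt_w3.lean`) has the conjunct INJ_top: an injection of `Sel^{sat}_∞(θ)[π]` into `N` copies of
`AcSigned.selmer W p κ ↑S₀ (.sgn ε)[p]` with `p^N ≤ #(𝒪/π)`. This file proves that conclusion VERBATIM (for generic `M, R, j` in place of `(F/𝒪)(θ), 𝒪, j`)
from (I8) the inert local square / cores data the LEAD constructs from the INJTOP binders and (I1)–(I7) the T-side inputs of the hands (INPUT SPEC, bus
2026-08-30): coordinates `s_l : M → W_K[p^∞]` (honda), the twist `û` with its `W[p]`-shadow `(u, v)` and BRIDGE (honda + -w3 g18 ∘ p767784), joint injectivity on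
`M[π]` at level `∞` (§2(c), g18), and the numerology `p^(2J) ≤ #(R/π)`.

HOW (memo `Lines/rtt_w3-GLUE-g7.md`, ∞-level design): for `x ∈ Sel^{sat}_∞[π]` choose a layer `m` and an `M[π]`-valued representative `φ` (g17 p765246);
push along `s_l` and `û ∘ s_l` (D3-b `exists_cocycle_comp`; p769763 gives the three descent inputs); the coordinates are the LEVEL-`∞` classes
`cor_∞ e_∞^* subgroupH1Iso res_= res^{K_m}_{K_∞} [ψ]` (members of the Selmer group and `p`-torsion by p769542 = p768739 + p768913). Injectivity: equal images ⇒ the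
differences of the level-`∞` pullbacks have vanishing cor-pairs ⇒ (p769671, block I at `∞`) every `[s_l ∘ φ_d] = 0` ⇒ (`hjoint`) `[φ_d] = 0` ⇒ `x₁ = x₂`.
THEOREM ONLY; BSD / crux L / INJ_top for the actual `θ` are NOT proved here (the hands' inputs (I1)–(I7) remain). [cite: Kobayashi2003, Def. 1.1]
[cite: BDKim2009, pp. 182, 185] [cite: SerreGaloisCohomology1997, I §2.4, I §5.8] [cite: NeukirchSchmidtWingberg2008, (1.5.7)]
-/

set_option linter.dupNamespace false -- D-0017: single-problem summit, the namespace repeats the problem name by design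

noncomputable section

open scoped Classical

namespace Summit.BirchSwinnertonDyer.BirchSwinnertonDyer.Theorems.SmallImageCharSignedSelmer

open NumberField IsDedekindDomain Field Literature.NumberTheory.EllipticCurves Literature.NumberTheory.GaloisRepresentations
  Literature.NumberTheory.EllipticCurves.GreenbergSelmer Literature.NumberTheory.EllipticCurves.GreenbergVatsal2000
  Summit.BirchSwinnertonDyer.Rank1Residual.Additive.LocalTransport Summit.BirchSwinnertonDyer.Rank1Residual.Additive.BaseChange
  Literature.NumberTheory.EllipticCurves.AcSigned Kobayashi2003 WeierstrassCurve Rat.HeightOneSpectrum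

section Generic

variable {G : Type} [Group G] [TopologicalSpace G] [IsTopologicalGroup G] {A : Type} [AddCommGroup A] [DistribMulAction G A]
  [TopologicalSpace A] [DiscreteTopology A]

/-- Classes of differences of cocycles (bookkeeping). [folklore] -/
theorem oneCocycleClass_sub_eq (f g : contOneCocycles (discreteTopRep G A)) :
    oneCocycleClass (discreteTopRep G A) (f - g) = oneCocycleClass (discreteTopRep G A) f - oneCocycleClass (discreteTopRep G A) g :=
  map_sub (classHom G A) f g

end Generic

section InjTop

variable (K : Type) [Field K] [NumberField K] (hK2 : Module.finrank ℚ K = 2) {p : ℕ} [hp : Fact p.Prime] (hp2 : p ≠ 2)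
  (κ : ZpExtension ℚ p) (hκ : κ.IsCyclotomic) (v₀ : HeightOneSpectrum (𝓞 ℚ)) (hv₀ : ((p : ℕ) : 𝓞 ℚ) ∈ v₀.asIdeal)
  (w : HeightOneSpectrum (𝓞 K)) [hw : w.asIdeal.LiesOver v₀.asIdeal]
  (ι : AlgebraicClosure ℚ →ₐ[ℚ] AlgebraicClosure (v₀.adicCompletion ℚ))
  (ι₂ : AlgebraicClosure (v₀.adicCompletion ℚ) ≃+* AlgebraicClosure (w.adicCompletion K))
  (hcompat : ∀ z : AlgebraicClosure ℚ, closureEmb (K := K) (w.adicCompletion K) (closureEmb (K := ℚ) K z) = ι₂ (ι z))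
  (hι₂ : ∀ y : v₀.adicCompletion ℚ, ι₂ (algebraMap (v₀.adicCompletion ℚ) (AlgebraicClosure (v₀.adicCompletion ℚ)) y) =
    algebraMap (w.adicCompletion K) (AlgebraicClosure (w.adicCompletion K)) (adicCompletionMap (K := ℚ) K v₀ w y))
  (hfixU : ∀ h : absoluteGaloisGroup (v₀.adicCompletion ℚ), resGalOfEmb ι h ∈ galRange (K := ℚ) K → ∀ y : w.adicCompletion K,
    (show AlgebraicClosure (v₀.adicCompletion ℚ) ≃ₐ[v₀.adicCompletion ℚ] AlgebraicClosure (v₀.adicCompletion ℚ) from h)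
        (ι₂.symm (algebraMap (w.adicCompletion K) (AlgebraicClosure (w.adicCompletion K)) y)) =
      ι₂.symm (algebraMap (w.adicCompletion K) (AlgebraicClosure (w.adicCompletion K)) y))
  (W : WeierstrassCurve ℚ) [W.IsElliptic] (hirr : W.HasIrreducibleModPGaloisRep p) (ε : ℤˣ)
  (𝔪 : Ideal (𝓞 K)) (hbad : ∀ (ℓ : ℕ) [Fact ℓ.Prime], ℓ ∣ (NumberField.discr K).natAbs * Ideal.absNorm 𝔪 → ¬ W.HasGoodReductionAtPrime ℓ)
  (S₀ : Finset (HeightOneSpectrum (𝓞 ℚ))) (hS₀bad : ∀ v : HeightOneSpectrum (𝓞 ℚ), ¬ W.HasGoodReductionAt v → v ∈ S₀)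
  -- (I8) cores data at every layer and at level `∞`
  [hnorm : ∀ n : ℕ, ((galRange (K := ℚ) K).subgroupOf (κ.layerSubgroup n)).Normal] [((galRange (K := ℚ) K).subgroupOf κ.kerSubgroup).Normal]
  (e : ∀ n : ℕ, ((galRange (K := ℚ) K).subgroupOf (κ.layerSubgroup n)) →ₜ* (κ.layerSubgroup n ⊓ galRange (K := ℚ) K : Subgroup (absoluteGaloisGroup ℚ)))
  (he : ∀ (n : ℕ) (x : (galRange (K := ℚ) K).subgroupOf (κ.layerSubgroup n)),
    ((e n x : (κ.layerSubgroup n ⊓ galRange (K := ℚ) K : Subgroup (absoluteGaloisGroup ℚ))) : absoluteGaloisGroup ℚ) =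
      ((x : κ.layerSubgroup n) : absoluteGaloisGroup ℚ))
  (einf : ((galRange (K := ℚ) K).subgroupOf κ.kerSubgroup) →ₜ* (κ.kerSubgroup ⊓ galRange (K := ℚ) K : Subgroup (absoluteGaloisGroup ℚ)))
  (heinf : ∀ x : (galRange (K := ℚ) K).subgroupOf κ.kerSubgroup,
    ((einf x : (κ.kerSubgroup ⊓ galRange (K := ℚ) K : Subgroup (absoluteGaloisGroup ℚ))) : absoluteGaloisGroup ℚ) =
      ((x : κ.kerSubgroup) : absoluteGaloisGroup ℚ))
  (einf' : (κ.kerSubgroup ⊓ galRange (K := ℚ) K : Subgroup (absoluteGaloisGroup ℚ)) →ₜ* ((galRange (K := ℚ) K).subgroupOf κ.kerSubgroup))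
  (heinf' : ∀ x, einf (einf' x) = x)
  (incN : ∀ n : ℕ, ((galRange (K := ℚ) K).subgroupOf κ.kerSubgroup) →ₜ* ((galRange (K := ℚ) K).subgroupOf (κ.layerSubgroup n)))
  (hincN : ∀ (n : ℕ) (x : (galRange (K := ℚ) K).subgroupOf κ.kerSubgroup),
    ((incN n x : (galRange (K := ℚ) K).subgroupOf (κ.layerSubgroup n)) : κ.layerSubgroup n) =
      Subgroup.inclusion (κ.kerSubgroup_le_layerSubgroup n) (x : κ.kerSubgroup))
  {c : absoluteGaloisGroup (v₀.adicCompletion ℚ)} (hc : c ∈ localSubgroupOfEmb κ.kerSubgroup ι) (hcU : resGalOfEmb ι c ∉ galRange (K := ℚ) K)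
  (hN : ∀ n : ℕ, IsOpen (((galRange (K := ℚ) K).subgroupOf (κ.layerSubgroup n) : Subgroup (κ.layerSubgroup n)) : Set (κ.layerSubgroup n)))
  (hNinf : IsOpen (((galRange (K := ℚ) K).subgroupOf κ.kerSubgroup : Subgroup κ.kerSubgroup) : Set κ.kerSubgroup))
  (hMT : ∀ (n : ℕ) (m : W.geomPrimaryTorsion p), Continuous fun g : κ.layerSubgroup n ↦ g • m)
  (hMinf : ∀ m : W.geomPrimaryTorsion p, Continuous fun g : κ.kerSubgroup ↦ g • m)
  (hMpinf : ∀ m : geomTorsion W p, Continuous fun g : κ.kerSubgroup ↦ g • m)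
  (hopen : ∀ n : ℕ, IsOpen ((κ.layerSubgroup n ⊓ galRange (K := ℚ) K : Subgroup (absoluteGaloisGroup ℚ)) : Set (absoluteGaloisGroup ℚ)))
  -- the `θ`-side, generic: a discrete `Γ_K`-module `M` with commuting `R`-scalars, `j`, `π`, `M[π] = Sπ`
  {M : Type} [AddCommGroup M] [DistribMulAction (absoluteGaloisGroup K) M] [TopologicalSpace M] [DiscreteTopology M]
  {R : Type} [CommRing R] [Module R M] [SMulCommClass (absoluteGaloisGroup K) R M]
  (j : (W.baseChange K).geomPrimaryTorsion p →+ M) (π : R) (Sπ : AddSubgroup M) (hSπ : ∀ m, m ∈ Sπ ↔ π • m = 0)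
  (hMc : ∀ m : M, Continuous fun g : absoluteGaloisGroup K ↦ g • m) (hdiv : ∀ m : M, ∃ m' : M, π • m' = m)
  (hπp : ∀ m : M, π • m = 0 → p • m = 0)
  (hTc : ∀ m' : (W.baseChange K).geomPrimaryTorsion p, Continuous fun g : absoluteGaloisGroup K ↦ g • m')
  (htriv : ∀ (n : ℕ) (v : HeightOneSpectrum (𝓞 K)), v ∉ {w' : HeightOneSpectrum (𝓞 K) | ∃ v ∈ S₀, ((natGenerator v : ℕ) : 𝓞 K) ∈ w'.asIdeal} →
    ((p : ℕ) : 𝓞 K) ∉ v.asIdeal → ∀ (x : inertiaIn ((κ.restrictOfFinrankEqTwo hp2 K hK2).layerSubgroup n) v) (m : M), x • m = m)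
  -- (I1)–(I2) the coordinates (honda)
  (J : ℕ) (s : Fin J → (M →+ (W.baseChange K).geomPrimaryTorsion p))
  (hs_loc : ∀ (l : Fin J) (v : HeightOneSpectrum (𝓞 K)), (p : 𝓞 K) ∈ v.asIdeal →
    ∀ (δ : absoluteGaloisGroup (v.adicCompletion K)) (m : M),
      s l (resGalOfEmb (closureEmb (K := K) (v.adicCompletion K)) δ • m) = resGalOfEmb (closureEmb (K := K) (v.adicCompletion K)) δ • s l m)
  (hs_gen : ∀ (l : Fin J) (n : ℕ) (v : HeightOneSpectrum (𝓞 K)), (p : 𝓞 K) ∈ v.asIdeal →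
    ∀ f ∈ localSatGen (W.baseChange K) p ((κ.restrictOfFinrankEqTwo hp2 K hK2).layerSubgroup n) (closureEmb (K := K) (v.adicCompletion K)) M R j
        (signedLocalPoints (κ.restrictOfFinrankEqTwo hp2 K hK2) (v.adicCompletion K) (W.baseChange K) ε n),
      (fun τ ↦ s l (f τ)) ∈ AddSubgroup.closure (localSatGen (W.baseChange K) p ((κ.restrictOfFinrankEqTwo hp2 K hK2).layerSubgroup n)
        (closureEmb (K := K) (v.adicCompletion K)) ((W.baseChange K).geomPrimaryTorsion p) ℤ (AddMonoidHom.id _)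
        (signedLocalPoints (κ.restrictOfFinrankEqTwo hp2 K hK2) (v.adicCompletion K) (W.baseChange K) ε n)))
  (hs_S : ∀ (l : Fin J) (g : absoluteGaloisGroup K) (m : M), m ∈ Sπ → s l (g • m) = g • s l m)
  -- (I3) the twist (honda)
  (û : (W.baseChange K).geomPrimaryTorsion p →+ (W.baseChange K).geomPrimaryTorsion p)
  (hû_loc : ∀ v : HeightOneSpectrum (𝓞 K), (p : 𝓞 K) ∈ v.asIdeal →
    ∀ (δ : absoluteGaloisGroup (v.adicCompletion K)) (x : (W.baseChange K).geomPrimaryTorsion p),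
      û (resGalOfEmb (closureEmb (K := K) (v.adicCompletion K)) δ • x) = resGalOfEmb (closureEmb (K := K) (v.adicCompletion K)) δ • û x)
  (hû_stab : ∀ (n : ℕ) (v : HeightOneSpectrum (𝓞 K)), (p : 𝓞 K) ∈ v.asIdeal →
    ∀ (Q : localPoints (W.baseChange K) (v.adicCompletion K)) (k : ℕ)
      (t : localSubgroupOfEmb ((κ.restrictOfFinrankEqTwo hp2 K hK2).layerSubgroup n) (closureEmb (K := K) (v.adicCompletion K)) →
        (W.baseChange K).geomPrimaryTorsion p),
      (p ^ k) • Q ∈ signedLocalPoints (κ.restrictOfFinrankEqTwo hp2 K hK2) (v.adicCompletion K) (W.baseChange K) ε n →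
      (∀ τ, pointsMapOfEmb (W.baseChange K) (closureEmb (K := K) (v.adicCompletion K))
          ((t τ : (W.baseChange K).geomPrimaryTorsion p) : (W.baseChange K).geomPoints) = (τ : absoluteGaloisGroup (v.adicCompletion K)) • Q - Q) →
      ∃ (Q' : localPoints (W.baseChange K) (v.adicCompletion K)) (k' : ℕ),
        (p ^ k') • Q' ∈ signedLocalPoints (κ.restrictOfFinrankEqTwo hp2 K hK2) (v.adicCompletion K) (W.baseChange K) ε n ∧
        ∀ τ, pointsMapOfEmb (W.baseChange K) (closureEmb (K := K) (v.adicCompletion K))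
            ((û (t τ) : (W.baseChange K).geomPrimaryTorsion p) : (W.baseChange K).geomPoints) = (τ : absoluteGaloisGroup (v.adicCompletion K)) • Q' - Q')
  -- (I4) the `W[p]`-shadow of the twist (-w3 g18 ∘ p767784) and the bridge
  (u v : geomTorsion W p →+ geomTorsion W p)
  (hu : ∀ τ : absoluteGaloisGroup ℚ, τ ∈ galRange (K := ℚ) K → ∀ m : geomTorsion W p, u (τ • m) = τ • u m)
  (hv : ∀ τ : absoluteGaloisGroup ℚ, τ ∈ galRange (K := ℚ) K → ∀ m : geomTorsion W p, v (τ • m) = τ • v m)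
  (hcu : ∀ m : geomTorsion W p, u (resGalOfEmb ι c • m) = -(resGalOfEmb ι c • u m)) (hvu : ∀ m : geomTorsion W p, v (u m) = m)
  (hbridge : ∀ a : geomTorsion W p,
    û (primaryBaseChangeEquiv K W p (AddSubgroup.inclusion (W.geomTorsion_le_geomPrimaryTorsion p) a)) =
      primaryBaseChangeEquiv K W p (AddSubgroup.inclusion (W.geomTorsion_le_geomPrimaryTorsion p) (u a)))
  -- (I6) joint injectivity of the coordinates on `M[π]` at level `∞` (§2(c), g18) and (I7) the numerology
  (hjoint : ∀ φ : contOneCocycles (discreteTopRep (κ.restrictOfFinrankEqTwo hp2 K hK2).kerSubgroup M), (∀ x, φ.1 x ∈ Sπ) →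
    (∀ (l : Fin J) (ψ : contOneCocycles (discreteTopRep (κ.restrictOfFinrankEqTwo hp2 K hK2).kerSubgroup ((W.baseChange K).geomPrimaryTorsion p))),
      (∀ x, ψ.1 x = s l (φ.1 x)) → oneCocycleClass _ ψ = 0) → oneCocycleClass _ φ = 0)
  (hJ : p ^ (2 * J) ≤ Nat.card (R ⧸ Ideal.span {π}))

set_option maxHeartbeats 400000 in
omit hnorm [SMulCommClass (absoluteGaloisGroup K) R M] in
include hp2 hirr heinf heinf' hMpinf hSπ hπp hu hv hcu hvu hbridge hjoint in
/-- **Injectivity step of `injTop_of_inputs`** (separate declaration to keep elaboration small): if two classes with layer representatives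
`φ₁, φ₂` (values in `M[π]`) have equal level-`∞` coordinate classes for every `l` and both twists, their level-`∞` restrictions agree.
[cite: SerreGaloisCohomology1997, I §2.4, I §5.8] -/
theorem resOfLe_eq_of_coordinates_eq (m₁ m₂ : ℕ)
    (φ₁ : contOneCocycles (discreteTopRep ((κ.restrictOfFinrankEqTwo hp2 K hK2).layerSubgroup m₁) M)) (hφ₁ : ∀ y, φ₁.1 y ∈ Sπ)
    (φ₂ : contOneCocycles (discreteTopRep ((κ.restrictOfFinrankEqTwo hp2 K hK2).layerSubgroup m₂) M)) (hφ₂ : ∀ y, φ₂.1 y ∈ Sπ)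
    (ψ₁ ψ₁' : Fin J → contOneCocycles (discreteTopRep ((κ.restrictOfFinrankEqTwo hp2 K hK2).layerSubgroup m₁) ((W.baseChange K).geomPrimaryTorsion p)))
    (hψ₁ : ∀ l y, (ψ₁ l).1 y = s l (φ₁.1 y)) (hψ₁' : ∀ l y, (ψ₁' l).1 y = û (s l (φ₁.1 y)))
    (ψ₂ ψ₂' : Fin J → contOneCocycles (discreteTopRep ((κ.restrictOfFinrankEqTwo hp2 K hK2).layerSubgroup m₂) ((W.baseChange K).geomPrimaryTorsion p)))
    (hψ₂ : ∀ l y, (ψ₂ l).1 y = s l (φ₂.1 y)) (hψ₂' : ∀ l y, (ψ₂' l).1 y = û (s l (φ₂.1 y)))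
    (hEqΨ : ∀ l : Fin J,
      corH1 hNinf hMinf (xor_mem_subgroupOf_of_index_two κ.kerSubgroup (galRange (K := ℚ) K) ι (index_galRange_eq_two K hK2) hc hcU)
        (resH1Hom einf (AddMonoidHom.id (W.geomPrimaryTorsion p)) (smul_eq_smul_of_coe_eq W p κ.kerSubgroup (galRange (K := ℚ) K) einf heinf)
          (subgroupH1Iso K W p (inf_le_right : κ.kerSubgroup ⊓ galRange (K := ℚ) K ≤ galRange (K := ℚ) K)
            ((W.baseChange K).resOfLe p (le_of_eq (comapResGal_kerSubgroup_inf_galRange hp2 κ K hK2))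
              ((W.baseChange K).resOfLe p ((κ.restrictOfFinrankEqTwo hp2 K hK2).kerSubgroup_le_layerSubgroup m₁) (oneCocycleClass _ (ψ₁ l)))))) =
      corH1 hNinf hMinf (xor_mem_subgroupOf_of_index_two κ.kerSubgroup (galRange (K := ℚ) K) ι (index_galRange_eq_two K hK2) hc hcU)
        (resH1Hom einf (AddMonoidHom.id (W.geomPrimaryTorsion p)) (smul_eq_smul_of_coe_eq W p κ.kerSubgroup (galRange (K := ℚ) K) einf heinf)
          (subgroupH1Iso K W p (inf_le_right : κ.kerSubgroup ⊓ galRange (K := ℚ) K ≤ galRange (K := ℚ) K)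
            ((W.baseChange K).resOfLe p (le_of_eq (comapResGal_kerSubgroup_inf_galRange hp2 κ K hK2))
              ((W.baseChange K).resOfLe p ((κ.restrictOfFinrankEqTwo hp2 K hK2).kerSubgroup_le_layerSubgroup m₂) (oneCocycleClass _ (ψ₂ l)))))))
    (hEqΨ' : ∀ l : Fin J,
      corH1 hNinf hMinf (xor_mem_subgroupOf_of_index_two κ.kerSubgroup (galRange (K := ℚ) K) ι (index_galRange_eq_two K hK2) hc hcU)
        (resH1Hom einf (AddMonoidHom.id (W.geomPrimaryTorsion p)) (smul_eq_smul_of_coe_eq W p κ.kerSubgroup (galRange (K := ℚ) K) einf heinf)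
          (subgroupH1Iso K W p (inf_le_right : κ.kerSubgroup ⊓ galRange (K := ℚ) K ≤ galRange (K := ℚ) K)
            ((W.baseChange K).resOfLe p (le_of_eq (comapResGal_kerSubgroup_inf_galRange hp2 κ K hK2))
              ((W.baseChange K).resOfLe p ((κ.restrictOfFinrankEqTwo hp2 K hK2).kerSubgroup_le_layerSubgroup m₁) (oneCocycleClass _ (ψ₁' l)))))) =
      corH1 hNinf hMinf (xor_mem_subgroupOf_of_index_two κ.kerSubgroup (galRange (K := ℚ) K) ι (index_galRange_eq_two K hK2) hc hcU)
        (resH1Hom einf (AddMonoidHom.id (W.geomPrimaryTorsion p)) (smul_eq_smul_of_coe_eq W p κ.kerSubgroup (galRange (K := ℚ) K) einf heinf)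
          (subgroupH1Iso K W p (inf_le_right : κ.kerSubgroup ⊓ galRange (K := ℚ) K ≤ galRange (K := ℚ) K)
            ((W.baseChange K).resOfLe p (le_of_eq (comapResGal_kerSubgroup_inf_galRange hp2 κ K hK2))
              ((W.baseChange K).resOfLe p ((κ.restrictOfFinrankEqTwo hp2 K hK2).kerSubgroup_le_layerSubgroup m₂) (oneCocycleClass _ (ψ₂' l))))))) :
    resOfLe M ((κ.restrictOfFinrankEqTwo hp2 K hK2).kerSubgroup_le_layerSubgroup m₁) (oneCocycleClass _ φ₁) =
      resOfLe M ((κ.restrictOfFinrankEqTwo hp2 K hK2).kerSubgroup_le_layerSubgroup m₂) (oneCocycleClass _ φ₂) := by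
  -- level-`∞` pullbacks (restriction on classes = pullback on cocycles); bundle both indices as `Bool`-indexed data is overkill: do it twice
  have hle₁ := (κ.restrictOfFinrankEqTwo hp2 K hK2).kerSubgroup_le_layerSubgroup m₁
  have hle₂ := (κ.restrictOfFinrankEqTwo hp2 K hK2).kerSubgroup_le_layerSubgroup m₂
  -- the pulled-back cocycles
  have hP : ∀ (l : Fin J), ∃ (A A' B B' : contOneCocycles (discreteTopRep (κ.restrictOfFinrankEqTwo hp2 K hK2).kerSubgroup
      ((W.baseChange K).geomPrimaryTorsion p))),
      (W.baseChange K).resOfLe p hle₁ (oneCocycleClass _ (ψ₁ l)) = oneCocycleClass _ A ∧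
      (W.baseChange K).resOfLe p hle₁ (oneCocycleClass _ (ψ₁' l)) = oneCocycleClass _ A' ∧
      (W.baseChange K).resOfLe p hle₂ (oneCocycleClass _ (ψ₂ l)) = oneCocycleClass _ B ∧
      (W.baseChange K).resOfLe p hle₂ (oneCocycleClass _ (ψ₂' l)) = oneCocycleClass _ B' ∧
      (∀ y, A.1 y = s l (φ₁.1 (subgroupInclusion hle₁ y))) ∧ (∀ y, A'.1 y = û (s l (φ₁.1 (subgroupInclusion hle₁ y)))) ∧
      (∀ y, B.1 y = s l (φ₂.1 (subgroupInclusion hle₂ y))) ∧ (∀ y, B'.1 y = û (s l (φ₂.1 (subgroupInclusion hle₂ y)))) := fun l ↦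
    ⟨_, _, _, _, resOfLe_oneCocycleClass_pullback _ _, resOfLe_oneCocycleClass_pullback _ _, resOfLe_oneCocycleClass_pullback _ _,
      resOfLe_oneCocycleClass_pullback _ _,
      fun y ↦ by rw [pullback_resHomOfEquivariant_apply, AddMonoidHom.id_apply, hψ₁],
      fun y ↦ by rw [pullback_resHomOfEquivariant_apply, AddMonoidHom.id_apply, hψ₁'],
      fun y ↦ by rw [pullback_resHomOfEquivariant_apply, AddMonoidHom.id_apply, hψ₂],
      fun y ↦ by rw [pullback_resHomOfEquivariant_apply, AddMonoidHom.id_apply, hψ₂']⟩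
  choose A A' B B' hA hA' hB hB' hAv hA'v hBv hB'v using hP
  obtain ⟨Φ₁, hΦ₁, hΦ₁v⟩ : ∃ Φ : contOneCocycles (discreteTopRep (κ.restrictOfFinrankEqTwo hp2 K hK2).kerSubgroup M),
      resOfLe M hle₁ (oneCocycleClass _ φ₁) = oneCocycleClass _ Φ ∧ ∀ y, Φ.1 y = φ₁.1 (subgroupInclusion hle₁ y) :=
    ⟨_, resOfLe_oneCocycleClass_pullback _ _, fun y ↦ by rw [pullback_resHomOfEquivariant_apply, AddMonoidHom.id_apply]⟩
  obtain ⟨Φ₂, hΦ₂, hΦ₂v⟩ : ∃ Φ : contOneCocycles (discreteTopRep (κ.restrictOfFinrankEqTwo hp2 K hK2).kerSubgroup M),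
      resOfLe M hle₂ (oneCocycleClass _ φ₂) = oneCocycleClass _ Φ ∧ ∀ y, Φ.1 y = φ₂.1 (subgroupInclusion hle₂ y) :=
    ⟨_, resOfLe_oneCocycleClass_pullback _ _, fun y ↦ by rw [pullback_resHomOfEquivariant_apply, AddMonoidHom.id_apply]⟩
  -- pointwise facts on the differences
  have hdp : ∀ (l : Fin J) y, p • (A l - B l).1 y = 0 := fun l y ↦ by
    rw [sub_apply_val, hAv, hBv, smul_sub, ← map_nsmul (s l), ← map_nsmul (s l), hπp _ ((hSπ _).1 (hφ₁ _)), hπp _ ((hSπ _).1 (hφ₂ _)),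
      map_zero, sub_zero]
  have hd' : ∀ (l : Fin J) y, (A' l - B' l).1 y = û ((A l - B l).1 y) := fun l y ↦ by
    rw [sub_apply_val, sub_apply_val, hA'v, hB'v, hAv, hBv, map_sub]
  -- vanishing cor-pairs ⇒ (block I at `∞`, p769671) `[A l - B l] = 0`
  have hzero : ∀ l : Fin J, oneCocycleClass _ (A l - B l) = 0 := fun l ↦ by
    refine oneCocycleClass_eq_zero_of_corH1_infty_pair_eq_zero K hK2 hp2 κ W hirr v₀ ι hc hcU hNinf hMinf hMpinf û u v hu hv hcu hvu hbridge
      einf heinf einf' heinf' (A l - B l) (A' l - B' l) (hdp l) (hd' l) ?_ ?_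
    · rw [oneCocycleClass_sub_eq, map_sub, map_sub, map_sub, map_sub, sub_eq_zero, ← hA l, ← hB l]
      exact hEqΨ l
    · rw [oneCocycleClass_sub_eq, map_sub, map_sub, map_sub, map_sub, sub_eq_zero, ← hA' l, ← hB' l]
      exact hEqΨ' l
  -- joint injectivity on `M[π]` (I6)
  have hΦd0 : oneCocycleClass _ (Φ₁ - Φ₂) = 0 := by
    refine hjoint _ (fun y ↦ by rw [sub_apply_val, hΦ₁v, hΦ₂v]; exact Sπ.sub_mem (hφ₁ _) (hφ₂ _)) fun l ψ hψ ↦ ?_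
    have hψeq : ψ = A l - B l := by
      apply Subtype.ext
      apply ContinuousMap.ext
      intro y
      rw [hψ, sub_apply_val, sub_apply_val, hAv, hBv, hΦ₁v, hΦ₂v, map_sub]
    rw [hψeq]
    exact hzero l
  rw [hΦ₁, hΦ₂, ← sub_eq_zero, ← oneCocycleClass_sub_eq]
  exact hΦd0

include hκ hv₀ hw hcompat hι₂ hfixU hirr hbad hS₀bad he heinf heinf' hincN hc hcU hN hNinf hMT hMinf hMpinf hopen hSπ hMc hdiv hπp hTc htriv hs_loc hs_gen hs_S hû_loc hû_stab
  hu hv hcu hvu hbridge hjoint hJ in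
/-- ★★★ **`injTop_of_inputs` — the composition of the cores route.** Under the inert local square and cores data (I8) and the T-side inputs (I1)–(I7), the
INJ_top conclusion holds for `(M, R, j, π)`: there are `N = 2J` with `p^N ≤ #(R/π)` and an injection of `{x ∈ Sel^{ε,S₀K}_R(K_∞, M) | π·x = 0}` into
`Fin N → AcSigned.selmer W p κ ↑S₀ (fun _ ↦ .sgn ε)[p]`, `x ↦ (cor_∞ e_∞^* iso res (s_l ∘ φ_x), cor_∞ e_∞^* iso res (û ∘ s_l ∘ φ_x))_l`.
[cite: Kobayashi2003, Def. 1.1] [cite: BDKim2009, pp. 182, 185] [cite: SerreGaloisCohomology1997, I §2.4, I §5.8] [cite: NeukirchSchmidtWingberg2008, (1.5.7)] -/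
theorem injTop_of_inputs :
    ∃ N : ℕ, p ^ N ≤ Nat.card (R ⧸ Ideal.span {π}) ∧
      ∃ incl : {x : signedTransportSelmerInftySat (κ.restrictOfFinrankEqTwo hp2 K hK2) M R (W.baseChange K) j
          {w' : HeightOneSpectrum (𝓞 K) | ∃ v ∈ S₀, ((natGenerator v : ℕ) : 𝓞 K) ∈ w'.asIdeal} ε |
            GreenbergSelmer.scalarH1 (κ.restrictOfFinrankEqTwo hp2 K hK2).kerSubgroup M π x = 0} →
          (Fin N → {y : selmer W p κ (S₀ : Set (HeightOneSpectrum (𝓞 ℚ))) (fun _ ↦ PCond.sgn ε) | p • y = 0}),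
        Function.Injective incl := by
  -- names
  have hpw : (p : 𝓞 K) ∈ w.asIdeal := by
    have h := hv₀
    rw [hw.over, Ideal.under_def, Ideal.mem_comap, map_natCast] at h
    exact h
  -- (0) `û` is `Γ_K`-equivariant on `W_K[p]` (bridge + `u` is `galRange`-equivariant)
  have hû_tors : ∀ (g : absoluteGaloisGroup K) (x : (W.baseChange K).geomPrimaryTorsion p), p • x = 0 → û (g • x) = g • û x := by
    intro g x hx
    have hx' : p • (primaryBaseChangeEquiv K W p).symm x = 0 := by rw [← map_nsmul, hx, map_zero]
    obtain ⟨a, ha⟩ := mem_range_inclusion_of_nsmul_eq_zero _ hx'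
    have hxa : x = primaryBaseChangeEquiv K W p (AddSubgroup.inclusion (W.geomTorsion_le_geomPrimaryTorsion p) a) := by
      rw [ha, AddEquiv.apply_symm_apply]
    have hsm : ∀ b : geomTorsion W p, g • primaryBaseChangeEquiv K W p (AddSubgroup.inclusion (W.geomTorsion_le_geomPrimaryTorsion p) b) =
        primaryBaseChangeEquiv K W p (AddSubgroup.inclusion (W.geomTorsion_le_geomPrimaryTorsion p) (resGal (K := ℚ) K g • b)) := fun b ↦ by
      rw [← primaryBaseChangeEquiv_smul K W p g, Subgroup.smul_def, coe_resGalToRange, inclusion_geomTorsion_smul]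
    rw [hxa, hsm, hbridge, hbridge, hsm, hu _ ((mem_galRange_iff K _).2 ⟨g, rfl⟩)]
  -- (1) the twisted coordinates inherit the hypotheses (p769763)
  have htw := fun l : Fin J ↦ coordinate_hyps_comp (κ.restrictOfFinrankEqTwo hp2 K hK2) (W.baseChange K) ε π Sπ hSπ hπp (s l) (hs_loc l)
    (hs_gen l) (hs_S l) û hû_loc hû_stab hû_tors
  -- (2) layer representatives with values in `M[π]` (g17 p765246)
  have hrep : ∀ x : {x : signedTransportSelmerInftySat (κ.restrictOfFinrankEqTwo hp2 K hK2) M R (W.baseChange K) j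
      {w' : HeightOneSpectrum (𝓞 K) | ∃ v ∈ S₀, ((natGenerator v : ℕ) : 𝓞 K) ∈ w'.asIdeal} ε |
        GreenbergSelmer.scalarH1 (κ.restrictOfFinrankEqTwo hp2 K hK2).kerSubgroup M π x = 0},
      ∃ (m : ℕ) (φ : contOneCocycles (discreteTopRep ((κ.restrictOfFinrankEqTwo hp2 K hK2).layerSubgroup m) M)),
        (∀ y, φ.1 y ∈ Sπ) ∧
        oneCocycleClass _ φ ∈ signedTransportSelmerLayerSat (κ.restrictOfFinrankEqTwo hp2 K hK2) M R (W.baseChange K) j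
          {w' : HeightOneSpectrum (𝓞 K) | ∃ v ∈ S₀, ((natGenerator v : ℕ) : 𝓞 K) ∈ w'.asIdeal} ε m ∧
        resOfLe M ((κ.restrictOfFinrankEqTwo hp2 K hK2).kerSubgroup_le_layerSubgroup m) (oneCocycleClass _ φ) =
          ((x : signedTransportSelmerInftySat (κ.restrictOfFinrankEqTwo hp2 K hK2) M R (W.baseChange K) j
            {w' : HeightOneSpectrum (𝓞 K) | ∃ v ∈ S₀, ((natGenerator v : ℕ) : 𝓞 K) ∈ w'.asIdeal} ε) :
              subgroupH1 (κ.restrictOfFinrankEqTwo hp2 K hK2).kerSubgroup M) := by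
    intro x
    obtain ⟨m, φ, hφπ, hφc, hφx⟩ := exists_layer_cocycle_of_scalarH1_eq_zero (κ.restrictOfFinrankEqTwo hp2 K hK2) (W.baseChange K) j
      {w' : HeightOneSpectrum (𝓞 K) | ∃ v ∈ S₀, ((natGenerator v : ℕ) : 𝓞 K) ∈ w'.asIdeal} ε hMc hdiv x.1.2 x.2
    exact ⟨m, φ, fun y ↦ (hSπ _).2 (hφπ y), hφc, hφx⟩
  choose mOf φOf hφS hφsat hφx using hrep
  -- (3) the pushed cocycles along `s l` and `û ∘ s l` (D3-b `exists_cocycle_comp`)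
  have hSstab : ∀ (H : Subgroup (absoluteGaloisGroup K)) (y : H) (m : M), m ∈ Sπ → (y : absoluteGaloisGroup K) • m ∈ Sπ := fun H y m hm ↦ by
    rw [hSπ] at hm ⊢
    rw [← smul_comm, hm, smul_zero]
  have hψex : ∀ x (l : Fin J), ∃ ψ : contOneCocycles (discreteTopRep ((κ.restrictOfFinrankEqTwo hp2 K hK2).layerSubgroup (mOf x))
      ((W.baseChange K).geomPrimaryTorsion p)), ∀ y, ψ.1 y = s l ((φOf x).1 y) := fun x l ↦ by
    obtain ⟨ψ, hψ⟩ := exists_cocycle_comp Sπ (hSstab _) ((s l).comp Sπ.subtype) (fun y m ↦ hs_S l (y : absoluteGaloisGroup K) m m.2) (φOf x) (hφS x)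
    exact ⟨ψ, fun y ↦ by rw [hψ]; rfl⟩
  choose ψOf hψOf using hψex
  have hψex' : ∀ x (l : Fin J), ∃ ψ : contOneCocycles (discreteTopRep ((κ.restrictOfFinrankEqTwo hp2 K hK2).layerSubgroup (mOf x))
      ((W.baseChange K).geomPrimaryTorsion p)), ∀ y, ψ.1 y = û (s l ((φOf x).1 y)) := fun x l ↦ by
    obtain ⟨ψ, hψ⟩ := exists_cocycle_comp Sπ (hSstab _) ((û.comp (s l)).comp Sπ.subtype)
      (fun y m ↦ (htw l).2.2 (y : absoluteGaloisGroup K) m m.2) (φOf x) (hφS x)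
    exact ⟨ψ, fun y ↦ by rw [hψ]; rfl⟩
  choose ψ'Of hψ'Of using hψex'
  -- (4) the three descent inputs for both (p769763)
  have hD := fun x (l : Fin J) ↦ descInputs_of_coordinate (κ.restrictOfFinrankEqTwo hp2 K hK2) (W.baseChange K)
    {w' : HeightOneSpectrum (𝓞 K) | ∃ v ∈ S₀, ((natGenerator v : ℕ) : 𝓞 K) ∈ w'.asIdeal} ε π Sπ hSπ hπp hTc htriv (s l) (hs_loc l) (hs_gen l) (hs_S l)
    (mOf x) (φOf x) (hφS x) (hφsat x) (ψOf x l) (hψOf x l)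
  have hD' := fun x (l : Fin J) ↦ descInputs_of_coordinate (κ.restrictOfFinrankEqTwo hp2 K hK2) (W.baseChange K)
    {w' : HeightOneSpectrum (𝓞 K) | ∃ v ∈ S₀, ((natGenerator v : ℕ) : 𝓞 K) ∈ w'.asIdeal} ε π Sπ hSπ hπp hTc htriv (û.comp (s l)) (htw l).1 (htw l).2.1
    (htw l).2.2 (mOf x) (φOf x) (hφS x) (hφsat x) (ψ'Of x l) (fun y ↦ by rw [hψ'Of, AddMonoidHom.comp_apply])
  -- (5) the level-`∞` classes: membership and `p`-torsion (p769542)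
  have hΨ := fun x (l : Fin J) ↦ corH1_infty_mem_acSignedSelmer K hK2 hp2 κ W (mOf x) (e (mOf x)) (he (mOf x)) einf heinf (incN (mOf x))
    (hincN (mOf x)) hκ v₀ hv₀ w ι ι₂ hcompat hι₂ hfixU ε 𝔪 hbad S₀ hS₀bad hc hcU (hN _) hNinf (hMT _) hMinf (hopen _)
    (oneCocycleClass _ (ψOf x l)) (hD x l).1 ((hD x l).2.1 w hpw) (hD x l).2.2
  have hΨ' := fun x (l : Fin J) ↦ corH1_infty_mem_acSignedSelmer K hK2 hp2 κ W (mOf x) (e (mOf x)) (he (mOf x)) einf heinf (incN (mOf x))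
    (hincN (mOf x)) hκ v₀ hv₀ w ι ι₂ hcompat hι₂ hfixU ε 𝔪 hbad S₀ hS₀bad hc hcU (hN _) hNinf (hMT _) hMinf (hopen _)
    (oneCocycleClass _ (ψ'Of x l)) (hD' x l).1 ((hD' x l).2.1 w hpw) (hD' x l).2.2
  -- (6) the map
  refine ⟨J + J, by rwa [← two_mul], fun x ↦ Fin.append (fun l ↦ ⟨⟨_, (hΨ x l).1⟩, Subtype.ext ?_⟩) (fun l ↦ ⟨⟨_, (hΨ' x l).1⟩, Subtype.ext ?_⟩), ?_⟩
  · rw [AddSubgroupClass.coe_nsmul, ZeroMemClass.coe_zero]; exact (hΨ x l).2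
  · rw [AddSubgroupClass.coe_nsmul, ZeroMemClass.coe_zero]; exact (hΨ' x l).2
  -- (7) injectivity
  intro x₁ x₂ hEq
  apply Subtype.ext
  apply Subtype.ext
  rw [← hφx x₁, ← hφx x₂]
  refine resOfLe_eq_of_coordinates_eq (K := K) (hK2 := hK2) (hp2 := hp2) (κ := κ) (v₀ := v₀) (ι := ι) (W := W) (hirr := hirr) (einf := einf)
    (heinf := heinf) (einf' := einf') (heinf' := heinf') (hc := hc) (hcU := hcU) (hNinf := hNinf) (hMinf := hMinf) (hMpinf := hMpinf) (π := π)
    (Sπ := Sπ) (hSπ := hSπ) (hπp := hπp) (J := J) (s := s) (û := û) (u := u) (v := v) (hu := hu) (hv := hv) (hcu := hcu) (hvu := hvu)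
    (hbridge := hbridge) (hjoint := hjoint) (mOf x₁) (mOf x₂) (φOf x₁) (hφS x₁) (φOf x₂) (hφS x₂) (fun l ↦ ψOf x₁ l) (fun l ↦ ψ'Of x₁ l)
    (fun l ↦ hψOf x₁ l) (fun l ↦ hψ'Of x₁ l) (fun l ↦ ψOf x₂ l) (fun l ↦ ψ'Of x₂ l) (fun l ↦ hψOf x₂ l) (fun l ↦ hψ'Of x₂ l)
    (fun l ↦ ?_) (fun l ↦ ?_)
  · have h1 := congrFun hEq (Fin.castAdd J l)
    simp only [Fin.append_left] at h1
    exact congrArg Subtype.val (congrArg Subtype.val h1)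
  · have h2 := congrFun hEq (Fin.natAdd J l)
    simp only [Fin.append_right] at h2
    exact congrArg Subtype.val (congrArg Subtype.val h2)

end InjTop

end Summit.BirchSwinnertonDyer.BirchSwinnertonDyer.Theorems.SmallImageCharSignedSelmer

end
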